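import Mathlib

/-!
# Stub `stub_tangencySets` of the crux `LevelOneGL2Designs` (stmt-MatrixMultiplication-14080) —
wall-breaker axis 10/12 (Hermitian unital constructions), part 3: the stub versus the
prime-saving conjecture of Hunter–Pohoata–Verstraëte–Zhang

`IM(2,q)`, the largest induced matching of the point–line incidence graph of `𝔽_q²`
(pairs `(pᵢ, ℓᵢ)` with `pᵢ ∈ ℓⱼ ↔ i = j`), satisfies `IM(2,q) ≤ q^{3/2} + q` (Vinh 2011), sharp for
square `q` by the Hermitian unital (part 2 of this series proves the unital half in Lean), while for
PRIME `q` the record is `IM(2,q) ≫ q^{1.2334}` and Hunter–Pohoata–Verstraëte–Zhang conjecture a power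
SAVING: `IM(2,q) ≤ q^{3/2 - c}` for all large primes [HunterPohoataVerstraeteZhang2026, Conj. 10.2]
("one cannot realize a unitary-like configuration over a prime field"); they show it would imply
power savings for Paley clique numbers and for the Furstenberg–Sárközy problem.

`stub_tangencySets_false_of_primeSaving`: that conjecture — stated in coordinates: a point set
`V ⊆ (ZMod p)²` every point of which has an affine line through it meeting `V` only there has
`|V| ≤ p^{3/2-c}` for all primes `p ≥ p₀` — REFUTES `stub_tangencySets` (a witness of the stub at `p` is such a `V` of size `≥ c·p^{3/2}`:
its point set, cf. `tangencySet_of_srs` of part 1, re-derived inline here).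
So the packing stub of line `Sketch` asserts the failure, along a sequence of primes, of a 2026
conjecture; it is recorded here as a kernel-checked implication with the conjecture as hypothesis
(nothing is claimed about the conjecture itself).
-/

-- justification: the tree path `MatrixMultiplication/MatrixMultiplication` (summit = problem) makes every
-- declaration name contain a duplicated namespace segment, which this linter would flag.
set_option linter.dupNamespace false

noncomputable section

open scoped BigOperators
open Finset Matrix

namespace Summit.MatrixMultiplication.MatrixMultiplication.Theorems.LevelOneGL2Designs.FlagLine.TangencyHermitian

/-- **The prime-saving conjecture refutes the stub.**  Hypothesis `hconj` is
[HunterPohoataVerstraeteZhang2026, Conjecture 10.2] in coordinates: for some `c > 0` and all primes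
`p ≥ p₀`, every point set `V ⊆ (ZMod p)²` admitting a tangent line at each of its points (= the
point set of an induced point–line matching; every affine line is `{w : u ⬝ᵥ w = t}`, `u ≠ 0`) has
at most `p^{3/2 - c}` points.  Conclusion: `stub_tangencySets` (SRS of size `c'·p^{3/2}` for
unboundedly many primes, in the normal form `u_f ⬝ᵥ v_{f'} = 1 ↔ f = f'`) fails — take a witness at
a prime `p > (1/c')^{1/c}`, pass to its point set by `tangencySet_of_srs`, and compare
`c'·p^{3/2} ≤ |V| ≤ p^{3/2}·p^{-c} < c'·p^{3/2}`. [cite: HunterPohoataVerstraeteZhang2026, Conj. 10.2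
(hypothesis only)] -/
theorem stub_tangencySets_false_of_primeSaving
    (hconj : ∃ c : ℝ, 0 < c ∧ ∃ p₀ : ℕ, ∀ (p : ℕ) [Fact p.Prime], p₀ ≤ p →
      ∀ V : Finset (Fin 2 → ZMod p),
        (∀ v ∈ V, ∃ u : Fin 2 → ZMod p, u ≠ 0 ∧ ∀ w ∈ V, u ⬝ᵥ w = u ⬝ᵥ v → w = v) →
          (V.card : ℝ) ≤ (p : ℝ) ^ (3 / 2 - c)) :
    ¬ (∃ c : ℝ, 0 < c ∧ ∀ p₀ : ℕ, ∃ (p : ℕ) (_ : Fact p.Prime), p₀ ≤ p ∧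
      ∃ S : Finset ((Fin 2 → ZMod p) × (Fin 2 → ZMod p)),
        c * (p : ℝ) ^ (3 / 2 : ℝ) ≤ S.card ∧
        ∀ f ∈ S, ∀ f' ∈ S, (dotProduct f.1 f'.2 = 1 ↔ f = f')) := by
  rintro ⟨c, hc, hfam⟩
  obtain ⟨c', hc', p₀, hbound⟩ := hconj
  obtain ⟨p, hp, hp₁, S, hS, hsrs⟩ := hfam (max p₀ (⌈(1 / c) ^ (1 / c')⌉₊ + 1))
  haveI : Fact p.Prime := hp
  have hp₀ : p₀ ≤ p := le_trans (le_max_left _ _) hp₁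
  have hbig : (1 / c) ^ (1 / c') < (p : ℝ) := by
    have h1 : ⌈(1 / c) ^ (1 / c')⌉₊ + 1 ≤ p := le_trans (le_max_right _ _) hp₁
    have h2 : ((⌈(1 / c) ^ (1 / c')⌉₊ : ℕ) : ℝ) + 1 ≤ p := by exact_mod_cast h1
    have h3 := Nat.le_ceil ((1 / c) ^ (1 / c'))
    linarith
  -- the point set of the witness is a tangency set of the same size (part 1's `tangencySet_of_srs`,
  -- re-derived inline so that this file depends on Mathlib only)
  obtain ⟨V, hV, htan⟩ : ∃ V : Finset (Fin 2 → ZMod p), V.card = S.card ∧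
      ∀ v ∈ V, ∃ u : Fin 2 → ZMod p, u ≠ 0 ∧ ∀ w ∈ V, u ⬝ᵥ w = u ⬝ᵥ v → w = v := by
    have hinj : Set.InjOn Prod.snd (S : Set ((Fin 2 → ZMod p) × (Fin 2 → ZMod p))) := by
      intro f hf f' hf' h
      have h1 : f.1 ⬝ᵥ f.2 = 1 := (hsrs f hf f hf).2 rfl
      exact (hsrs f hf f' hf').1 (by simpa [← h] using h1)
    refine ⟨S.image Prod.snd, Finset.card_image_of_injOn hinj, ?_⟩
    simp only [Finset.mem_image]
    rintro v ⟨f, hf, rfl⟩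
    have h1 : f.1 ⬝ᵥ f.2 = 1 := (hsrs f hf f hf).2 rfl
    refine ⟨f.1, ?_, ?_⟩
    · rintro h0
      rw [h0, zero_dotProduct] at h1
      exact zero_ne_one h1
    · rintro w ⟨f', hf', rfl⟩ h
      rw [h1] at h
      rw [(hsrs f hf f' hf').1 h]
  have hVle : (V.card : ℝ) ≤ (p : ℝ) ^ (3 / 2 - c') := hbound p hp₀ V htan
  rw [hV] at hVle
  have hppos : (0 : ℝ) < p := by exact_mod_cast hp.out.pos
  have hA : (0 : ℝ) < (p : ℝ) ^ (3 / 2 : ℝ) := Real.rpow_pos_of_pos hppos _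
  -- c * p^{3/2} ≤ p^{-c'} * p^{3/2}
  have key : c * (p : ℝ) ^ (3 / 2 : ℝ) ≤ (p : ℝ) ^ (-c') * (p : ℝ) ^ (3 / 2 : ℝ) := by
    rw [← Real.rpow_add hppos]
    have h32 : -c' + (3 / 2 : ℝ) = 3 / 2 - c' := by ring
    rw [h32]
    exact hS.trans hVle
  have hc_le : c ≤ (p : ℝ) ^ (-c') := le_of_mul_le_mul_right key hA
  -- but p > (1/c)^{1/c'} means p^{-c'} < c
  have hlt : (p : ℝ) ^ (-c') < c := by
    have h1 : 1 / c < (p : ℝ) ^ c' := by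
      calc 1 / c = ((1 / c) ^ (1 / c')) ^ c' := by
            rw [← Real.rpow_mul (by positivity), one_div_mul_cancel hc'.ne', Real.rpow_one]
        _ < (p : ℝ) ^ c' := Real.rpow_lt_rpow (by positivity) hbig hc'
    rw [Real.rpow_neg hppos.le, ← one_div, one_div_lt (Real.rpow_pos_of_pos hppos _) hc]
    exact h1
  linarith

end Summit.MatrixMultiplication.MatrixMultiplication.Theorems.LevelOneGL2Designs.FlagLine.TangencyHermitian
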